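import Literature.AlgebraicGeometry.AbelianSchemes.KernelClauseSpecialOfGeneric
import HarnessLib

/-!
# A FACTORISATION THROUGH A CLOSED SUBSCHEME AT THE SCHEMATICALLY DOMINANT POINT OF A STAGE HOLDS OVER THE WHOLE STAGE
# ([EGAIV3] 11.10.1–11.10.5; [GortzWedhorn2020] Prop. 9.19, Rem. 9.20; [BoschLutkebohmertRaynaud1990] §2.5, §7.1)

Topic `AlgebraicGeometry/AbelianSchemes`, namespace `Literature.AlgebraicGeometry.AbelianSchemes` (sibling of ★ (v-gen) `KernelClauseSpecialOfGeneric`).  THEOREMS ONLY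
(no definition, no named fact, no instance, no notation, no `sorry`).  Cell `hodgecm-mathlib` (D-0151), F0∕P6 «MOD» (crux hLiu418 = stmt-HodgeConjecture-24832,
`--supports`, count-neutral), half-A line L2, organ **(IMG) «image line engine»** (LA2-plan (g2) deal 2026-09-02T08:41Z to A-p06 (g36)), bottom layer (a) of the
transfer row **(v-c) FACTORISATION** («a flat sub-object of the valuation-ring model that maps into a closed sub-object of the target GENERICALLY does so over the
whole model, hence on the special fibre») — the image-side twin of (v-gen)'s KILL `comp_eq_one_of_pullback_map_comp_eq_one`.  HONEST LABEL: HC_CM is proved only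
modulo the cell's 2 remaining named inputs (hLiu418 24832, h413 24833) until rung 0 closes; generic capital, pays no letter.

THE MATHEMATICS.  `V′` a scheme with a quasi-compact schematically dominant point `a′ : Spec Ω → V′` (the generic point of a valuation ring), `𝒦 → V′` FLAT, `ζ : 𝒵 ↪ 𝒴`
a closed immersion over `V′`, `φ : 𝒦 → 𝒴` over `V′`.  If the base change `φ_{a′}` factors through `ζ_{a′}`, then `φ` factors through `ζ` (uniquely): the base change
`𝒦_{a′} → 𝒦` is schematically dominant (`𝒦` flat; [EGAIV3] 11.10.5), and closed immersions are right-orthogonal to schematically dominant morphisms (★ (v-gen) §1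
`exists_lift_of_isClosedImmersion`; [GortzWedhorn2020] Rem. 9.20) — apply it to the square `𝒦_{a′} → 𝒵 ↪ 𝒴 ← 𝒦`.  Consequently `φ_{b′}` factors through `ζ_{b′}` after
EVERY base change `b′ : S″ → V′` (e.g. the special point of the stage).

* `exists_comp_eq_of_pullback_map` (the factorisation over `V′`), `comp_eq_of_comp_eq` (uniqueness of the factor: `ζ` is a monomorphism),
  `exists_comp_pullback_map_eq_of_pullback_map` (the factorisation at every base change).

## References
* [EGAIV3] A. Grothendieck, J. Dieudonné, EGA IV₃ (1966), 11.10.1–11.10.5.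
* [GortzWedhorn2020] U. Görtz, T. Wedhorn, *Algebraic Geometry I*, 2nd ed. (2020), Prop. 9.19, Rem. 9.20 (pp. 233–234).
* [BoschLutkebohmertRaynaud1990] S. Bosch, W. Lütkebohmert, M. Raynaud, *Néron Models* (1990), §2.5 Prop. 2, §7.1 Lemma 5 (pp. 174–176).
-/

set_option autoImplicit false

noncomputable section

set_option backward.isDefEq.respectTransparency false

universe u

open CategoryTheory CategoryTheory.Limits AlgebraicGeometry

namespace Literature.AlgebraicGeometry.AbelianSchemes

section Factorisation

variable {V' : Scheme.{u}} {Ω : Type u} [Field Ω] (a' : Spec (.of Ω) ⟶ V') [QuasiCompact a'] [IsSchemeTheoreticallyDominant a']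
  {𝒦 𝒵 𝒴 : Over V'} [Flat 𝒦.hom] (φ : 𝒦 ⟶ 𝒴) (ζ : 𝒵 ⟶ 𝒴) [IsClosedImmersion ζ.left]

/-- **FACTORISATION THROUGH A CLOSED SUB-OBJECT IS DECIDED AT THE SCHEMATICALLY DOMINANT POINT.**  `𝒦 → V′` flat, `ζ : 𝒵 ↪ 𝒴` a closed immersion over `V′`,
`φ : 𝒦 → 𝒴`: if `φ_{a′}` factors through `ζ_{a′}` then `φ` factors through `ζ` over `V′` (the square `𝒦_{a′} → 𝒵 ↪ 𝒴 ← 𝒦` lifts: `𝒦_{a′} → 𝒦` is schematically dominant,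
★ (v-gen) `exists_lift_of_isClosedImmersion`). [cite: EGAIV3, 11.10.5] [cite: GortzWedhorn2020, Prop. 9.19 and Rem. 9.20 (pp. 233–234)]
[cite: BoschLutkebohmertRaynaud1990, §2.5 Prop. 2 (p. 174)] -/
theorem exists_comp_eq_of_pullback_map
    (h : ∃ m : (Over.pullback a').obj 𝒦 ⟶ (Over.pullback a').obj 𝒵, m ≫ (Over.pullback a').map ζ = (Over.pullback a').map φ) :
    ∃ m : 𝒦 ⟶ 𝒵, m ≫ ζ = φ := by
  obtain ⟨m, hm⟩ := h
  -- the square on underlying schemes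
  have hsq : (m.left ≫ pullback.fst 𝒵.hom a') ≫ ζ.left = pullback.fst 𝒦.hom a' ≫ φ.left := by
    have e3 := congrArg (fun f => CommaMorphism.left f ≫ pullback.fst 𝒴.hom a') hm
    simp only [Over.comp_left, Category.assoc, Over.pullback_map_left, pullback.lift_fst] at e3
    simpa only [Category.assoc] using e3
  obtain ⟨ℓ, hℓ, -⟩ := exists_lift_of_isClosedImmersion (pullback.fst 𝒦.hom a') ζ.left (m.left ≫ pullback.fst 𝒵.hom a') φ.left hsq
  refine ⟨Over.homMk ℓ (by rw [← Over.w ζ, ← Category.assoc, hℓ, Over.w φ]), ?_⟩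
  ext : 1
  exact hℓ

omit [QuasiCompact a'] [IsSchemeTheoreticallyDominant a'] [Flat 𝒦.hom] in
/-- The factor through a closed immersion is UNIQUE (`ζ` is a monomorphism). [cite: GortzWedhorn2020, Section (4.7) (p. 135)] -/
theorem comp_eq_of_comp_eq {m m' : 𝒦 ⟶ 𝒵} (hm : m ≫ ζ = φ) (hm' : m' ≫ ζ = φ) : m = m' := by
  haveI : Mono ζ := Over.mono_of_mono_left ζ
  rw [← cancel_mono ζ, hm, hm']

/-- **THE FACTORISATION AT EVERY BASE CHANGE OF THE STAGE** (e.g. the special point): if `φ_{a′}` factors through `ζ_{a′}` then `φ_{b′}` factors through `ζ_{b′}` for every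
`b′ : S″ → V′` (factor over `V′`, then `Over.pullback b′` is a functor). [cite: EGAIV3, 11.10.5] [cite: BoschLutkebohmertRaynaud1990, §7.1 Lemma 5 (p. 176)] -/
theorem exists_comp_pullback_map_eq_of_pullback_map
    (h : ∃ m : (Over.pullback a').obj 𝒦 ⟶ (Over.pullback a').obj 𝒵, m ≫ (Over.pullback a').map ζ = (Over.pullback a').map φ)
    {S'' : Scheme.{u}} (b' : S'' ⟶ V') :
    ∃ m : (Over.pullback b').obj 𝒦 ⟶ (Over.pullback b').obj 𝒵, m ≫ (Over.pullback b').map ζ = (Over.pullback b').map φ := by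
  obtain ⟨m, hm⟩ := exists_comp_eq_of_pullback_map a' φ ζ h
  exact ⟨(Over.pullback b').map m, by rw [← Functor.map_comp, hm]⟩

end Factorisation

end Literature.AlgebraicGeometry.AbelianSchemes

end
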